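import Summits.Ventures.HodgeRepro.Night4ReducedDimQuadRoute
import Summits.Ventures.HodgeRepro.Night4ReducedDimRoute

/-!
# The open frontier of degree 12 begins in dimension 7: `S4facesDeg 12 ⇐ printed ∧ Lemma R ∧ DimReduced ∧ Night4Classify12 ∧ (S4 on the faces of degree 12 with dim B_red ≥ 7)`

Blind re-derivation cell `pub-hodge-repro`, seat `night-4` (ROUTE HARDENING for the Monday FINAL, gen 6).  Target tree
path `lean/Summits/Ventures/HodgeRepro/Night4ReducedDimQuadFrontier.lean`.

The roster's faces (`TypeDatum.IsFace`: four pairwise distinct lifted corner types, (eq2) at `p = 2`, no two conjugate) of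
a type datum are exactly the conjugate-free `SumTwo` quadruples of its corner types (`TypeDatum.exists_quad_of_isFace`), so
the complete degree-12 tables (`Night4ReducedDimQuadRoute`) read on the roster:

* `TypeDatum.redDim_mem_of_order12` / `…_of_card_twelve` — every face of every type datum of degree 12 has
  `redDim ∈ {4, 7, 8, 9, 10, 12, 13, 14, 15, 16, 18, 19, 20, 21, 24}` (modulo `Night4Classify12` for an abstract group),
  `four_le_…`, and below 9 exactly `4`, `7`, `8`;
* `weil_le_alg_of_face_of_redDim_le_five` — with the dictionary `DimReduced` (`dim B_red = redDim`), every face whose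
  reduced dimension is ≤ 5 is CLOSED by Markman 2025 Cor 1.3 through Lemma R (`Night4KnownRegime`), in every degree;
  hence `S4faces ⇐ AlgPull ∧ LemmaR_faces ∧ DimReduced ∧ Markman2025_Cor1_3 ∧ S4faces_of_six_le` — the open frontier of
  S4 is the faces with `dim B_red ≥ 6` (`S4faces_of_frontier_six`);
* **`S4facesDeg12_of_frontier_seven`** — in degree 12 the frontier begins in dimension 7: `S4facesDeg 12 ⇐ AlgPull ∧
  LemmaR_faces ∧ DimReduced ∧ Markman2025_Cor1_3 ∧ Night4Classify12 ∧ S4facesDeg12_of_seven_le`, because no face of degree 12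
  has `dim B_red ∈ {5, 6}` and the fourfolds are closed; the hypothesis `S4facesDeg12_of_seven_le` (S4 on the faces of degree
  12 with `dim B_red ≥ 7`) is non-vacuous at 7 — the sevenfold `E × A₆` of `C6 × C2` is a face of its product datum
  (`night4Quad_C6xC2_seven_isFace`, gen 5) — and its smallest instances are ROUTE.md §3.5 (i)'s refinement for the record:
  the sevenfolds `E × A₆` (`C6 × C2`) and the eightfolds `S₂ × A₆` (`C12`, `Dic3`), before the census ninefolds.

NO open input is closed; HC_CM is NOT proved.  Nothing here says anything about the status of the Hodge conjecture for CM
abelian varieties.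
-/

set_option autoImplicit false

open Finset

namespace HodgeRepro.Route

/-! ## The faces of a type datum are the conjugate-free `SumTwo` quadruples of its corner types -/

/-- **A face of the roster is a conjugate-free `SumTwo` quadruple of CM types** with the same reduced dimension: the four
lifted corner types `φ_s`, `s ∈ Δ`, enumerated by `Fin 4`. -/
theorem TypeDatum.exists_quad_of_isFace (D : TypeDatum) (Δ : Finset D.S) (hΔ : D.IsFace Δ) :
    ∃ T : Fin 4 → Finset D.G, (∀ i, IsCMType D.c (T i)) ∧ SumTwo T ∧ ConjFree D.c T ∧
      D.redDim Δ = HodgeRepro.redDim T := by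
  obtain ⟨hcard, heq2, -, hconj⟩ := hΔ
  have hc4 : Fintype.card Δ = 4 := by rw [Fintype.card_coe, hcard]
  let e : Fin 4 ≃ Δ := (Fintype.equivFinOfCardEq hc4).symm
  refine ⟨fun i => D.liftedType (e i).1, fun i => D.liftedType_isCMType _, ?_, ?_, ?_⟩
  · intro t
    rw [← heq2.sum_liftedType_eq D t]
    refine Finset.card_bij (fun i _ => (e i).1) ?_ ?_ ?_
    · intro i hi
      simp only [mem_filter, mem_univ, true_and] at hi ⊢
      exact ⟨(e i).2, hi⟩
    · intro i _ j _ h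
      exact e.injective (Subtype.ext h)
    · intro s hs
      simp only [mem_filter] at hs
      exact ⟨e.symm ⟨s, hs.1⟩, by simp [mem_filter, hs.2], by simp⟩
  · intro i j _
    exact hconj _ (e i).2 _ (e j).2
  · unfold TypeDatum.redDim HodgeRepro.redDim
    congr 1
    ext x
    simp only [mem_image, mem_univ, true_and]
    constructor
    · rintro ⟨s, hs, rfl⟩
      exact ⟨e.symm ⟨s, hs⟩, by simp⟩
    · rintro ⟨i, rfl⟩
      exact ⟨(e i).1, (e i).2, rfl⟩

/-- **Every face of every classified type datum of degree 12 has `redDim ∈ night4QuadVals12`.** -/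
theorem TypeDatum.redDim_mem_of_order12 (D : TypeDatum) (hcl : Order12Classified D.c) (Δ : Finset D.S)
    (hΔ : D.IsFace Δ) : D.redDim Δ ∈ night4QuadVals12 := by
  obtain ⟨T, hT, hsum, hconj, he⟩ := D.exists_quad_of_isFace Δ hΔ
  rw [he]
  exact redDim_sumTwo_of_order12 hcl T hT hsum hconj

/-- `4 ≤ redDim` on every face of every classified type datum of degree 12. -/
theorem TypeDatum.four_le_redDim_of_order12 (D : TypeDatum) (hcl : Order12Classified D.c) (Δ : Finset D.S)
    (hΔ : D.IsFace Δ) : 4 ≤ D.redDim Δ := by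
  have h := D.redDim_mem_of_order12 hcl Δ hΔ
  simp only [night4QuadVals12, List.mem_cons, List.not_mem_nil, or_false] at h
  omega

/-- Below the census minimum exactly `4`, `7`, `8` on the faces of every classified type datum of degree 12. -/
theorem TypeDatum.redDim_lt_nine_iff_of_order12 (D : TypeDatum) (hcl : Order12Classified D.c) (Δ : Finset D.S)
    (hΔ : D.IsFace Δ) : D.redDim Δ < 9 ↔ D.redDim Δ = 4 ∨ D.redDim Δ = 7 ∨ D.redDim Δ = 8 := by
  have h := D.redDim_mem_of_order12 hcl Δ hΔ
  simp only [night4QuadVals12, List.mem_cons, List.not_mem_nil, or_false] at h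
  omega

/-- **Every face of every type datum of degree 12 has `redDim ∈ night4QuadVals12`**, modulo `Night4Classify12`. -/
theorem TypeDatum.redDim_mem_of_card_twelve (D : TypeDatum) (hcl : Night4Classify12) (h12 : Fintype.card D.G = 12)
    (Δ : Finset D.S) (hΔ : D.IsFace Δ) : D.redDim Δ ∈ night4QuadVals12 :=
  D.redDim_mem_of_order12 (Order12Classified_of_classify12 hcl h12 D.hc) Δ hΔ

/-- No face of a type datum of degree 12 has `redDim ∈ {5, 6}`, modulo `Night4Classify12`. -/
theorem TypeDatum.redDim_ne_five_six_of_card_twelve (D : TypeDatum) (hcl : Night4Classify12)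
    (h12 : Fintype.card D.G = 12) (Δ : Finset D.S) (hΔ : D.IsFace Δ) : D.redDim Δ ≠ 5 ∧ D.redDim Δ ≠ 6 := by
  have h := D.redDim_mem_of_card_twelve hcl h12 Δ hΔ
  simp only [night4QuadVals12, List.mem_cons, List.not_mem_nil, or_false] at h
  omega

/-! ## The frontier: faces with `dim B_red ≤ 5` are closed; in degree 12 the frontier begins at 7 -/

variable (𝓚 : KnownRegimeData)

/-- **Every face of reduced dimension ≤ 5 is closed**, in every degree: the dictionary `DimReduced` makes `B_red` an
abelian variety of dimension `redDim ≤ 5`, Markman 2025 Cor 1.3 makes its Hodge classes algebraic, Lemma R transfers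
(`Night4KnownRegime.weil_le_alg_of_face_of_dim_le_five`). -/
theorem weil_le_alg_of_face_of_redDim_le_five (hpull : AlgPull 𝓚.toRouteData) (hR : LemmaR_faces 𝓚)
    (hD : DimReduced 𝓚) (hM : Markman2025_Cor1_3 𝓚) {A : 𝓚.Var} (hA : 𝓚.IsCM A) {Δ : Finset (𝓚.typeOf A).S}
    (hΔ : (𝓚.typeOf A).IsFace Δ) (hdim : (𝓚.typeOf A).redDim Δ ≤ 5) :
    𝓚.weil 2 (𝓚.corner A Δ) ≤ 𝓚.alg 2 (𝓚.corner A Δ) := by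
  obtain ⟨hab, hd⟩ := hD A hA Δ hΔ
  exact weil_le_alg_of_face_of_dim_le_five 𝓚 hpull hR hM hA hΔ hab (by rw [hd]; exact hdim)

/-- **S4 on the faces of reduced dimension ≥ 6** — the open frontier of S4 in dimension terms (the faces of reduced
dimension ≤ 5 are closed by Markman through Lemma R).  A NAMED HYPOTHESIS; OPEN. -/
def S4faces_of_six_le : Prop :=
  ∀ A : 𝓚.Var, 𝓚.IsCM A → ∀ Δ : Finset (𝓚.typeOf A).S, (𝓚.typeOf A).IsFace Δ →
    6 ≤ (𝓚.typeOf A).redDim Δ → 𝓚.weil 2 (𝓚.corner A Δ) ≤ 𝓚.alg 2 (𝓚.corner A Δ)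

/-- **The open frontier of S4 is the faces with `dim B_red ≥ 6`**: `S4faces ⇐ AlgPull ∧ LemmaR_faces ∧ DimReduced ∧
Markman2025_Cor1_3 ∧ S4faces_of_six_le`. -/
theorem S4faces_of_frontier_six (hpull : AlgPull 𝓚.toRouteData) (hR : LemmaR_faces 𝓚) (hD : DimReduced 𝓚)
    (hM : Markman2025_Cor1_3 𝓚) (h6 : S4faces_of_six_le 𝓚) : S4faces 𝓚.toRouteData := by
  intro A hA Δ hΔ
  by_cases h : 6 ≤ (𝓚.typeOf A).redDim Δ
  · exact h6 A hA Δ hΔ h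
  · exact weil_le_alg_of_face_of_redDim_le_five 𝓚 hpull hR hD hM hA hΔ (by omega)

/-- **S4 on the faces of degree 12 of reduced dimension ≥ 7** — the open part of the degree-12 frontier: the sevenfolds
`E × A₆` of `C6 × C2`, the eightfolds `S₂ × A₆` of `C12` and `Dic3`, the census faces (`dim B_red ≥ 9`), and the larger
non-census classes.  A NAMED HYPOTHESIS; OPEN; non-vacuous at 7 (`night4Quad_C6xC2_seven_isFace`). -/
def S4facesDeg12_of_seven_le : Prop :=
  ∀ A : 𝓚.Var, 𝓚.IsCM A → Fintype.card (𝓚.typeOf A).G = 12 → ∀ Δ : Finset (𝓚.typeOf A).S, (𝓚.typeOf A).IsFace Δ →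
    7 ≤ (𝓚.typeOf A).redDim Δ → 𝓚.weil 2 (𝓚.corner A Δ) ≤ 𝓚.alg 2 (𝓚.corner A Δ)

/-- **In degree 12 the open frontier begins in dimension 7**: `S4facesDeg 12 ⇐ AlgPull ∧ LemmaR_faces ∧ DimReduced ∧
Markman2025_Cor1_3 ∧ Night4Classify12 ∧ S4facesDeg12_of_seven_le` — no face of degree 12 has `dim B_red ∈ {5, 6}` (the
complete tables) and the fourfolds are closed. -/
theorem S4facesDeg12_of_frontier_seven (hpull : AlgPull 𝓚.toRouteData) (hR : LemmaR_faces 𝓚) (hD : DimReduced 𝓚)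
    (hM : Markman2025_Cor1_3 𝓚) (hcl : Night4Classify12) (h7 : S4facesDeg12_of_seven_le 𝓚) :
    S4facesDeg 𝓚.toRouteData 12 := by
  intro A hA h12 Δ hΔ
  by_cases h : 7 ≤ (𝓚.typeOf A).redDim Δ
  · exact h7 A hA h12 Δ hΔ h
  · have hv := (𝓚.typeOf A).redDim_mem_of_card_twelve hcl h12 Δ hΔ
    refine weil_le_alg_of_face_of_redDim_le_five 𝓚 hpull hR hD hM hA hΔ ?_
    simp only [night4QuadVals12, List.mem_cons, List.not_mem_nil, or_false] at hv
    omega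

/-- The same with `S0`: `S0deg 12 ⇐ AlgPull ∧ S3 ∧ LemmasLPdeg 12 ∧ LemmaR_faces ∧ DimReduced ∧ Markman2025_Cor1_3 ∧
Night4Classify12 ∧ S4facesDeg12_of_seven_le` (through `LemmasLPdeg 12` and `S0deg_of_S3_S4deg`, as gen 1's
`S0deg6_of_Markman'`). -/
theorem S0deg12_of_frontier_seven (hpull : AlgPull 𝓚.toRouteData) (h3 : S3 𝓚.toRouteData)
    (hLP : LemmasLPdeg 𝓚.toRouteData 12) (hR : LemmaR_faces 𝓚) (hD : DimReduced 𝓚) (hM : Markman2025_Cor1_3 𝓚)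
    (hcl : Night4Classify12) (h7 : S4facesDeg12_of_seven_le 𝓚) : S0deg 𝓚.toRouteData 12 :=
  S0deg_of_S3_S4deg 𝓚.toRouteData hpull h3 (hLP (S4facesDeg12_of_frontier_seven 𝓚 hpull hR hD hM hcl h7))

end HodgeRepro.Route
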